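import Summits.Ventures.Crystal3D.Theorems.StickyWulffConstantCoaxialWallLawSeamDozenVacancyCensus
import HarnessLib

/-!
# CAP ROWS: the generic certificate-shaped input «around this exact partial environment a ball has at most eleven contacts» and its consumer
# (crux `CoaxialWallLaw`, stmt-Ventures-19481; lane F 'Certificates' v8.7, registered stubs `stub_satCensus11Glide` / `stub_satCensus11Cross`)

HONEST FRAMING. Venture `Summits/Ventures/Crystal3D` (cell `crystal3d-full`); helper for the amorphous deg-11 census pieces (seat 19481-p2 g16).  The GLIDE/CROSS
engine of record (E1 cascade + GAP(5/2) + `VacancyCapTwin`, g15 '…SeamFullCensusCert' for FULL) leaves at GLIDE ends ONE residual family (hcp trilayer around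
the target `b` with the in-layer DIVACANCY `{b + d, b + G(0,−1,1)}` and off-lattice pocket balls; memo HOME/wall-19481-p2/F-TAIL-g16.md), whose leaves close
numerically because ONE assumed-saturated contact `y` of `b` (the hexagon neighbour of a vacancy whose refill site is blocked by a pocket ball at distance `1/√3`)
cannot acquire its missing contacts (margin ≈ 6 % of the contact distance, kit j336787).  This file types the corresponding NAMED INPUT SCHEME, the analogue of
`DozenVacancyCap` ('…SeamDozenVacancyCensus') for an arbitrary exact partial environment, and proves its consumer once and for all:
* `CapTemplate k n` — `k` known unit contact vectors `c i` and `n` obstacle vectors `o j` with radii `r j` (model data around the origin);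
* **`CapRow T`** (named, certificate-shaped) — around every isometric copy `y + A(·)` of the template, every finite set `N` of FURTHER unit contacts of `y`
  (each `≥ 1` from the template contacts and `≥ r j` from obstacle `j`, pairwise `≥ 1`) has `N.card + k ≤ 11` — a `2(11 − k)`-dimensional cap-packing
  statement, to be certified by interval branch-and-bound exactly like `VacancyCapTwin` (cf-p2 PREREG §75);
* **`card_contacts_le_eleven_of_capRow`** — the consumer: in a `1`-separated `X`, a ball `y` whose template contacts are present and whose every other contact
  respects the obstacle radii has at most eleven contacts;
* the two obstacle dischargers the certificate checker needs: **`le_dist_of_present_obstacle`** (radius `1`: an obstacle ball of `X` that is not a contact of `y`)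
  and **`five_fourths_le_dist_of_saturated_obstacle`** (radius `5/4`: under GAP(5/2), an obstacle ball with all twelve contacts known, none of which is the new
  contact — `eq_or_dist_eq_one_or_le_dist_of_saturated`);
* `capRow_mono` — a row with MORE obstacles / larger radii follows from one with fewer / smaller (so certificates may be stated for minimal environments).
WHAT THIS IS NOT: no cap row is proved or asserted here (they are certificate-shaped inputs, numerics of record kit j336787: GLIDE rigid/pinned leaves 54/54
refuted with margin 0.048–0.068); the GLIDE checker/certificate is the sequel; F-C1 not moved.
-/

noncomputable section

namespace Summit.Ventures.Crystal3D.Theorems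

namespace TailResidue

open Summit.Ventures.Crystal3D Finset
open scoped InnerProductSpace

variable {X : Finset (EuclideanSpace ℝ (Fin 3))}

/-! ### Templates and the named input -/

/-- **A cap-row template**: `k` known unit contact vectors and `n` obstacles with radii, in model coordinates around the centre `0`. -/
structure CapTemplate (k n : ℕ) where
  /-- the known contacts (unit vectors) -/
  c : Fin k → EuclideanSpace ℝ (Fin 3)
  /-- the obstacle centres -/
  o : Fin n → EuclideanSpace ℝ (Fin 3)
  /-- the obstacle radii (`1` for a present ball, `5/4` for a saturated ball with known dozen) -/
  r : Fin n → ℝ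

/-- **CAP ROW (named input, certificate-shaped)** of the template `T`: for every isometry `A` and centre `y`, every finite set `N` of unit contacts of `y` that are
`≥ 1` from every template contact `y + A(c i)`, `≥ r j` from every obstacle `y + A(o j)`, and pairwise `≥ 1` apart, satisfies `N.card + k ≤ 11` — i.e. the
ball `y` cannot be completed to twelve contacts in this environment. -/
def CapRow {k n : ℕ} (T : CapTemplate k n) : Prop :=
  ∀ (A : EuclideanSpace ℝ (Fin 3) ≃ₗᵢ[ℝ] EuclideanSpace ℝ (Fin 3)) (y : EuclideanSpace ℝ (Fin 3)) (N : Finset (EuclideanSpace ℝ (Fin 3))),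
    (∀ x ∈ N, dist x y = 1) →
    (∀ x ∈ N, ∀ i : Fin k, 1 ≤ dist x (y + A (T.c i))) →
    (∀ x ∈ N, ∀ j : Fin n, T.r j ≤ dist x (y + A (T.o j))) →
    (∀ x ∈ N, ∀ x' ∈ N, x ≠ x' → 1 ≤ dist x x') →
    N.card + k ≤ 11

/-- **Monotonicity**: a template obtained by restricting the obstacles along `ι` and not increasing their radii has a WEAKER row; so a row certified for a
sub-environment serves every environment containing it. -/
theorem capRow_mono {k n n' : ℕ} {T : CapTemplate k n} {T' : CapTemplate k n'} (hc : T'.c = T.c) (ι : Fin n' → Fin n)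
    (ho : ∀ j, T'.o j = T.o (ι j)) (hr : ∀ j, T'.r j ≤ T.r (ι j)) (h : CapRow T') : CapRow T := by
  intro A y N h1 h2 h3 h4
  refine h A y N h1 (fun x hx i => ?_) (fun x hx j => ?_) h4
  · rw [hc]; exact h2 x hx i
  · rw [ho]; exact (hr j).trans (h3 x hx (ι j))

/-! ### The consumer -/

/-- A template contact `y + A(c i)` is at distance `1` from `y` when `‖c i‖ = 1`. -/
theorem dist_center_templateContact {k n : ℕ} (T : CapTemplate k n) (hcn : ∀ i, ‖T.c i‖ = 1)
    (A : EuclideanSpace ℝ (Fin 3) ≃ₗᵢ[ℝ] EuclideanSpace ℝ (Fin 3)) (y : EuclideanSpace ℝ (Fin 3)) (i : Fin k) :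
    dist y (y + A (T.c i)) = 1 := by
  rw [dist_comm, dist_eq_norm, add_sub_cancel_left, LinearIsometryEquiv.norm_map, hcn i]

open scoped Classical in
/-- **CONSUMER OF A CAP ROW.**  In a `1`-separated `X`: if `CapRow T` holds, the template contacts `y + A(c i)` of a ball `y ∈ X` are balls of `X` (`c` injective
unit vectors), and every OTHER contact `x ∈ X` of `y` is at distance `≥ r j` from each obstacle `y + A(o j)`, then `y` has at most eleven contacts. -/
theorem card_contacts_le_eleven_of_capRow {k n : ℕ} {T : CapTemplate k n} (hT : CapRow T)
    (hX : ∀ p ∈ X, ∀ q ∈ X, p ≠ q → 1 ≤ dist p q) (A : EuclideanSpace ℝ (Fin 3) ≃ₗᵢ[ℝ] EuclideanSpace ℝ (Fin 3)) {y : EuclideanSpace ℝ (Fin 3)}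
    (hcn : ∀ i, ‖T.c i‖ = 1) (hcinj : Function.Injective T.c) (hc : ∀ i, y + A (T.c i) ∈ X)
    (ho : ∀ x ∈ X, dist x y = 1 → (∀ i, x ≠ y + A (T.c i)) → ∀ j, T.r j ≤ dist x (y + A (T.o j))) :
    (X.filter fun q => dist y q = 1).card ≤ 11 := by
  set C := X.filter fun q => dist y q = 1 with hC
  set K : Finset (EuclideanSpace ℝ (Fin 3)) := univ.image fun i : Fin k => y + A (T.c i) with hK
  have hKinj : Function.Injective fun i : Fin k => y + A (T.c i) := fun i i' h => hcinj (A.injective (add_left_cancel h))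
  have hKcard : K.card = k := by rw [hK, card_image_of_injective _ hKinj, card_univ, Fintype.card_fin]
  have hKsub : K ⊆ C := by
    intro x hx
    obtain ⟨i, -, rfl⟩ := mem_image.1 hx
    exact mem_filter.2 ⟨hc i, dist_center_templateContact T hcn A y i⟩
  set N := C \ K with hN
  have hNmem : ∀ x ∈ N, x ∈ X ∧ dist x y = 1 ∧ ∀ i, x ≠ y + A (T.c i) := by
    intro x hx
    obtain ⟨hxC, hxK⟩ := mem_sdiff.1 hx
    refine ⟨(mem_filter.1 hxC).1, by rw [dist_comm]; exact (mem_filter.1 hxC).2, fun i h => hxK ?_⟩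
    exact mem_image.2 ⟨i, mem_univ _, h.symm⟩
  have h1 : ∀ x ∈ N, dist x y = 1 := fun x hx => (hNmem x hx).2.1
  have h2 : ∀ x ∈ N, ∀ i : Fin k, 1 ≤ dist x (y + A (T.c i)) := fun x hx i =>
    hX x (hNmem x hx).1 _ (hc i) ((hNmem x hx).2.2 i)
  have h3 : ∀ x ∈ N, ∀ j : Fin n, T.r j ≤ dist x (y + A (T.o j)) := fun x hx j =>
    ho x (hNmem x hx).1 (hNmem x hx).2.1 (hNmem x hx).2.2 j
  have h4 : ∀ x ∈ N, ∀ x' ∈ N, x ≠ x' → 1 ≤ dist x x' := fun x hx x' hx' hne => hX x (hNmem x hx).1 x' (hNmem x' hx').1 hne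
  have hrow := hT A y N h1 h2 h3 h4
  have hCcard : C.card = N.card + K.card := by
    rw [hN, card_sdiff_of_subset hKsub]
    have := card_le_card hKsub
    omega
  omega

/-! ### Discharging the obstacle hypotheses -/

/-- **Radius-`1` obstacles.**  A ball `p ∈ X` that is not a contact of `y` is at distance `≥ 1` from every contact `x ∈ X` of `y`. -/
theorem le_dist_of_present_obstacle (hX : ∀ p ∈ X, ∀ q ∈ X, p ≠ q → 1 ≤ dist p q) {y p x : EuclideanSpace ℝ (Fin 3)} (hp : p ∈ X)
    (hpy : dist p y ≠ 1) (hx : x ∈ X) (hxy : dist x y = 1) : 1 ≤ dist x p := by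
  refine hX x hx p hp fun h => hpy ?_
  rw [← h, hxy]

open scoped Classical in
/-- **Radius-`5/4` obstacles.**  Under GAP(5/2): a saturated ball `p ∈ X` (twelve contacts) all of whose contacts lie in the list `D`, which is not itself a contact of
`y`, is at distance `≥ 5/4` from every contact `x ∈ X` of `y` outside `D`. -/
theorem five_fourths_le_dist_of_saturated_obstacle (hg : KissingGap (5 / 2)) (hX : ∀ p ∈ X, ∀ q ∈ X, p ≠ q → 1 ≤ dist p q)
    {y p x : EuclideanSpace ℝ (Fin 3)} (hp : p ∈ X) (h12 : (X.filter fun q => dist p q = 1).card = 12) {D : Finset (EuclideanSpace ℝ (Fin 3))}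
    (hD : ∀ q ∈ X, dist p q = 1 → q ∈ D) (hpy : dist p y ≠ 1) (hx : x ∈ X) (hxy : dist x y = 1) (hxD : x ∉ D) :
    5 / 4 ≤ dist x p := by
  rcases eq_or_dist_eq_one_or_le_dist_of_saturated hg hX hp h12 hx with h | h | h
  · exact absurd (h ▸ hxy) hpy
  · exact absurd (hD x hx h) hxD
  · rw [dist_comm]; linarith

/-- **Radius-`5/4` obstacles, list form** (the shape the certificate checker produces: the known dozen of `p` as a list of twelve present balls). -/
theorem five_fourths_le_dist_of_dozen_obstacle (hg : KissingGap (5 / 2)) (hX : ∀ p ∈ X, ∀ q ∈ X, p ≠ q → 1 ≤ dist p q)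
    {y p x : EuclideanSpace ℝ (Fin 3)} (hp : p ∈ X) {D : Finset (EuclideanSpace ℝ (Fin 3))} (hDX : D ⊆ X) (hDcard : D.card = 12)
    (hDdist : ∀ q ∈ D, dist p q = 1) (hpy : dist p y ≠ 1) (hx : x ∈ X) (hxy : dist x y = 1) (hxD : x ∉ D) :
    5 / 4 ≤ dist x p := by
  classical
  have hsub : D ⊆ X.filter fun q => dist p q = 1 := fun q hq => mem_filter.2 ⟨hDX hq, hDdist q hq⟩
  have hle := card_filter_dist_eq_one_le_twelve X hX p
  have h12 : (X.filter fun q => dist p q = 1).card = 12 := le_antisymm hle (hDcard ▸ card_le_card hsub)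
  have hD : ∀ q ∈ X, dist p q = 1 → q ∈ D := by
    intro q hq hd
    have heq : D = X.filter fun q => dist p q = 1 := eq_of_subset_of_card_le hsub (by rw [hDcard, h12])
    rw [heq]; exact mem_filter.2 ⟨hq, hd⟩
  exact five_fourths_le_dist_of_saturated_obstacle hg hX hp h12 hD hpy hx hxy hxD

end TailResidue

end Summit.Ventures.Crystal3D.Theorems

end
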